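import Summits.Ventures.PercRepro.S4MidKeyBase

/-!
# PercRepro — THE MIDDLE KEY AT LEVEL `7`: THE NUMERALS `Φ(p, 7)` FOR `p = 26 … 45` (p1, gen 45; an S4 feeder — p9 owns SUBCLAIM-S4; no window claim here)

The second batch of the numerals `phiK_<word>_seven` (S4MidKeyBase holds `p = 10 … 25`), for the rows `26 … 45` of the middle key
with four or more layers (proofs/P1-HYPKEY.md §15). From `phiK_eq_two_pow_sub` by `norm_num`. Axioms: standard.
-/

open scoped Matroid

namespace PercRepro

namespace S4Mid

/-- `Φ(26, 7) = 795199 / 396`. -/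
theorem phiK_twentysix_seven : phiK 26 7 = 795199 / 396 := by
  rw [HypKey.phiK_eq_two_pow_sub 26 7 (by norm_num), Nat.choose_symm_add]
  simp only [Finset.sum_range_succ, Finset.sum_range_zero]
  norm_num [Nat.choose_eq_descFactorial_div_factorial, Nat.descFactorial_succ, Nat.descFactorial_zero, Nat.factorial]

/-- `Φ(27, 7) = 2386785 / 748`. -/
theorem phiK_twentyseven_seven : phiK 27 7 = 2386785 / 748 := by
  rw [HypKey.phiK_eq_two_pow_sub 27 7 (by norm_num), Nat.choose_symm_add]
  simp only [Finset.sum_range_succ, Finset.sum_range_zero]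
  norm_num [Nat.choose_eq_descFactorial_div_factorial, Nat.descFactorial_succ, Nat.descFactorial_zero, Nat.factorial]

/-- `Φ(28, 7) = 4775066 / 935`. -/
theorem phiK_twentyeight_seven : phiK 28 7 = 4775066 / 935 := by
  rw [HypKey.phiK_eq_two_pow_sub 28 7 (by norm_num), Nat.choose_symm_add]
  simp only [Finset.sum_range_succ, Finset.sum_range_zero]
  norm_num [Nat.choose_eq_descFactorial_div_factorial, Nat.descFactorial_succ, Nat.descFactorial_zero, Nat.factorial]

/-- `Φ(29, 7) = 138504029 / 16830`. -/
theorem phiK_twentynine_seven : phiK 29 7 = 138504029 / 16830 := by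
  rw [HypKey.phiK_eq_two_pow_sub 29 7 (by norm_num), Nat.choose_symm_add]
  simp only [Finset.sum_range_succ, Finset.sum_range_zero]
  norm_num [Nat.choose_eq_descFactorial_div_factorial, Nat.descFactorial_succ, Nat.descFactorial_zero, Nat.factorial]

/-- `Φ(30, 7) = 7487614 / 561`. -/
theorem phiK_thirty_seven : phiK 30 7 = 7487614 / 561 := by
  rw [HypKey.phiK_eq_two_pow_sub 30 7 (by norm_num), Nat.choose_symm_add]
  simp only [Finset.sum_range_succ, Finset.sum_range_zero]
  norm_num [Nat.choose_eq_descFactorial_div_factorial, Nat.descFactorial_succ, Nat.descFactorial_zero, Nat.factorial]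

/-- `Φ(31, 7) = 232133425 / 10659`. -/
theorem phiK_thirtyone_seven : phiK 31 7 = 232133425 / 10659 := by
  rw [HypKey.phiK_eq_two_pow_sub 31 7 (by norm_num), Nat.choose_symm_add]
  simp only [Finset.sum_range_succ, Finset.sum_range_zero]
  norm_num [Nat.choose_eq_descFactorial_div_factorial, Nat.descFactorial_succ, Nat.descFactorial_zero, Nat.factorial]

/-- `Φ(32, 7) = 14857221376 / 415701`. -/
theorem phiK_thirtytwo_seven : phiK 32 7 = 14857221376 / 415701 := by
  rw [HypKey.phiK_eq_two_pow_sub 32 7 (by norm_num), Nat.choose_symm_add]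
  simp only [Finset.sum_range_succ, Finset.sum_range_zero]
  norm_num [Nat.choose_eq_descFactorial_div_factorial, Nat.descFactorial_succ, Nat.descFactorial_zero, Nat.factorial]

/-- `Φ(33, 7) = 14857637077 / 251940`. -/
theorem phiK_thirtythree_seven : phiK 33 7 = 14857637077 / 251940 := by
  rw [HypKey.phiK_eq_two_pow_sub 33 7 (by norm_num), Nat.choose_symm_add]
  simp only [Finset.sum_range_succ, Finset.sum_range_zero]
  norm_num [Nat.choose_eq_descFactorial_div_factorial, Nat.descFactorial_succ, Nat.descFactorial_zero, Nat.factorial]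

/-- `Φ(34, 7) = 362387537 / 3705`. -/
theorem phiK_thirtyfour_seven : phiK 34 7 = 362387537 / 3705 := by
  rw [HypKey.phiK_eq_two_pow_sub 34 7 (by norm_num), Nat.choose_symm_add]
  simp only [Finset.sum_range_succ, Finset.sum_range_zero]
  norm_num [Nat.choose_eq_descFactorial_div_factorial, Nat.descFactorial_succ, Nat.descFactorial_zero, Nat.factorial]

/-- `Φ(35, 7) = 362391242 / 2223`. -/
theorem phiK_thirtyfive_seven : phiK 35 7 = 362391242 / 2223 := by
  rw [HypKey.phiK_eq_two_pow_sub 35 7 (by norm_num), Nat.choose_symm_add]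
  simp only [Finset.sum_range_succ, Finset.sum_range_zero]
  norm_num [Nat.choose_eq_descFactorial_div_factorial, Nat.descFactorial_succ, Nat.descFactorial_zero, Nat.factorial]

/-- `Φ(36, 7) = 67422040 / 247`. -/
theorem phiK_thirtysix_seven : phiK 36 7 = 67422040 / 247 := by
  rw [HypKey.phiK_eq_two_pow_sub 36 7 (by norm_num), Nat.choose_symm_add]
  simp only [Finset.sum_range_succ, Finset.sum_range_zero]
  norm_num [Nat.choose_eq_descFactorial_div_factorial, Nat.descFactorial_succ, Nat.descFactorial_zero, Nat.factorial]

/-- `Φ(37, 7) = 2494624619 / 5434`. -/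
theorem phiK_thirtyseven_seven : phiK 37 7 = 2494624619 / 5434 := by
  rw [HypKey.phiK_eq_two_pow_sub 37 7 (by norm_num), Nat.choose_symm_add]
  simp only [Finset.sum_range_succ, Finset.sum_range_zero]
  norm_num [Nat.choose_eq_descFactorial_div_factorial, Nat.descFactorial_succ, Nat.descFactorial_zero, Nat.factorial]

/-- `Φ(38, 7) = 554362234 / 715`. -/
theorem phiK_thirtyeight_seven : phiK 38 7 = 554362234 / 715 := by
  rw [HypKey.phiK_eq_two_pow_sub 38 7 (by norm_num), Nat.choose_symm_add]
  simp only [Finset.sum_range_succ, Finset.sum_range_zero]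
  norm_num [Nat.choose_eq_descFactorial_div_factorial, Nat.descFactorial_succ, Nat.descFactorial_zero, Nat.factorial]

/-- `Φ(39, 7) = 1663088847 / 1265`. -/
theorem phiK_thirtynine_seven : phiK 39 7 = 1663088847 / 1265 := by
  rw [HypKey.phiK_eq_two_pow_sub 39 7 (by norm_num), Nat.choose_symm_add]
  simp only [Finset.sum_range_succ, Finset.sum_range_zero]
  norm_num [Nat.choose_eq_descFactorial_div_factorial, Nat.descFactorial_succ, Nat.descFactorial_zero, Nat.factorial]

/-- `Φ(40, 7) = 566158336 / 253`. -/
theorem phiK_forty_seven : phiK 40 7 = 566158336 / 253 := by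
  rw [HypKey.phiK_eq_two_pow_sub 40 7 (by norm_num), Nat.choose_symm_add]
  simp only [Finset.sum_range_succ, Finset.sum_range_zero]
  norm_num [Nat.choose_eq_descFactorial_div_factorial, Nat.descFactorial_succ, Nat.descFactorial_zero, Nat.factorial]

/-- `Φ(41, 7) = 23212502149 / 6072`. -/
theorem phiK_fortyone_seven : phiK 41 7 = 23212502149 / 6072 := by
  rw [HypKey.phiK_eq_two_pow_sub 41 7 (by norm_num), Nat.choose_symm_add]
  simp only [Finset.sum_range_succ, Finset.sum_range_zero]
  norm_num [Nat.choose_eq_descFactorial_div_factorial, Nat.descFactorial_succ, Nat.descFactorial_zero, Nat.factorial]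

/-- `Φ(42, 7) = 3316072603 / 506`. -/
theorem phiK_fortytwo_seven : phiK 42 7 = 3316072603 / 506 := by
  rw [HypKey.phiK_eq_two_pow_sub 42 7 (by norm_num), Nat.choose_symm_add]
  simp only [Finset.sum_range_succ, Finset.sum_range_zero]
  norm_num [Nat.choose_eq_descFactorial_div_factorial, Nat.descFactorial_succ, Nat.descFactorial_zero, Nat.factorial]

/-- `Φ(43, 7) = 142591143687 / 12650`. -/
theorem phiK_fortythree_seven : phiK 43 7 = 142591143687 / 12650 := by
  rw [HypKey.phiK_eq_two_pow_sub 43 7 (by norm_num), Nat.choose_symm_add]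
  simp only [Finset.sum_range_succ, Finset.sum_range_zero]
  norm_num [Nat.choose_eq_descFactorial_div_factorial, Nat.descFactorial_succ, Nat.descFactorial_zero, Nat.factorial]

/-- `Φ(44, 7) = 570364625348 / 29325`. -/
theorem phiK_fortyfour_seven : phiK 44 7 = 570364625348 / 29325 := by
  rw [HypKey.phiK_eq_two_pow_sub 44 7 (by norm_num), Nat.choose_symm_add]
  simp only [Finset.sum_range_succ, Finset.sum_range_zero]
  norm_num [Nat.choose_eq_descFactorial_div_factorial, Nat.descFactorial_succ, Nat.descFactorial_zero, Nat.factorial]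

/-- `Φ(45, 7) = 1711093964019 / 50830`. -/
theorem phiK_fortyfive_seven : phiK 45 7 = 1711093964019 / 50830 := by
  rw [HypKey.phiK_eq_two_pow_sub 45 7 (by norm_num), Nat.choose_symm_add]
  simp only [Finset.sum_range_succ, Finset.sum_range_zero]
  norm_num [Nat.choose_eq_descFactorial_div_factorial, Nat.descFactorial_succ, Nat.descFactorial_zero, Nat.factorial]

end S4Mid

end PercRepro
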